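import Mathlib
import Literature.MathematicalPhysics.MHD.TearingHarrisSheet
import HarnessLib

/-!
# Nonlinear tearing: Rutherford's coefficient `ẇ_I = 1.22ηΔ′` from (4.40)–(4.42), White et al.'s finite-amplitude
# `Δ′(w_I)` and the SATURATED ISLAND WIDTH of the Harris sheet IN CLOSED FORM — Biskamp 2000 §4.1.2–§4.1.3, AS PRINTED

Topic `Literature/MathematicalPhysics/MHD` (namespace = path; sub-namespace `Tearing.Saturation`), REUSING BY NAME the
tree's Harris-sheet outer solution `Tearing.HarrisSheet.psi/psi'/psiPlus'/deltaPrime` (`TearingHarrisSheet.lean`,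
Schnack (34.31) = Biskamp (4.22)–(4.23)) and complementing `NeoclassicalTearingMode.lean` (island width, Miyamoto's
Rutherford equation, NTM).  Written for GRIDFUSION (lit-3; F3 resistive lane — the nonlinear end state of the
tearing benchmarks A11/A53/A64).

## What is printed (Biskamp 2000, read on the page) and what is typed
* (4.4)–(4.5) `ψ ≃ ½ψ₀″x² + ψ₁cos ky`, `w_I ≃ 4√(ψ₁/ψ₀″)`; (4.40) «`(4/π)A√(ψ₁/(2ψ₀″)) ψ̇₁ = ηΔ′ψ₁`», (4.41)
  `A = 1.827`, (4.42) «Hence we obtain `ẇ_I = 1.22ηΔ′`» — §1: with `ψ₁ = w²ψ₀″/16`, (4.40) IS `ẇ = (π/(√2A))ηΔ′`,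
  and ★ `1.215 < π/(√2·1.827) < 1.217` (the printed «1.22»; `A` itself is the printed numerical value of the double
  integral (4.41), VALIDATED input, not recomputed).
* (4.45) «`Δ′(w_I) = [ψ₁′(x_s + w_I/2) − ψ₁′(x_s − w_I/2)]/ψ₁(x_s)`», (4.47) for the sheet pinch `B_y = tanh(x/a)`
  «`Δ′(w_I) = (2/a)e^{−kw_I}[(1/(ka))sech²(w_I/2a) − ka − tanh(w_I/2a)]`» — §2: DEFINED over the tree's outer solution
  (4.22) and EVALUATED in the kernel: `Δ′(w) = (2/a)e^{−kw/2}[(1/(ka))sech²(w/2a) − ka − tanh(w/2a)]` — READING OF THE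
  PRINT: inserting the printed (4.22) into the printed (4.45) gives the exponential factor `e^{−kw_I/2}`, not the
  printed `e^{−kw_I}` (recorded, not adjudicated; the factor is positive, so the saturation condition below is
  unaffected); `Δ′(0) = (2/a)(1/(ka) − ka)` = the tree's `HarrisSheet.deltaPrime` (4.23); for `ka ≤ 1`,
  `Δ′(w) ≤ Δ′(0)` («In general `Δ′(w_I)` is a decreasing function of `w_I`»).
* (4.44) «`ẇ_I = 1.22η[Δ′(w_I) − αw_I]`», (4.46) «Saturation occurs for `Δ′(w_I) − αw_I = 0`», `α = (ka)² − 0.78` (fit),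
  (4.48) «`Δ′(w_I) = 0`, which is used in most practical applications» — §3: typed; and ★ FOR THE HARRIS SHEET (4.48) IS
  SOLVED IN CLOSED FORM: with `t = tanh(w/2a)` the bracket is the quadratic `(1 − t²)/(ka) − ka − t`, so for
  `0 < ka < 1` the saturated width is the unique `w_s > 0` with `tanh(w_s/2a) = t_s := (√(4 − 3k²a²) − ka)/2 ∈ (0, 1)`,
  i.e. `w_s = a·log((1 + t_s)/(1 − t_s))`; at the marginal point `ka = 1`, `t_s = 0` and `w_s = 0`.

THREE COLUMNS: CERTIFIED = the algebra/calculus above on the MODEL (incompressible reduced resistive MHD, constant-ψ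
islands, Rutherford regime, White et al.'s quasi-linear saturation rule with `α = 0`); VALIDATED = `A = 1.827`,
`α = (ka)² − 0.78`, «agreement … reasonably good for `w_I/a < 2`»; nothing about a device.

## Sources
* D. Biskamp, *Magnetic Reconnection in Plasmas*, CUP 2000 [Biskamp2000] §4.1 eqs. (4.4)–(4.5), §4.1.2 eqs.
  (4.31)–(4.43), §4.1.3 eqs. (4.44)–(4.48) [galaxy:panama:495441657462814 chunks p0115, p0119–p0122, read 2026-08-28].
* D. D. Schnack, *Lectures in MHD*, LNP 780 (2009) [Schnack2009] Lect. 34 eq. (34.31) — the Harris outer solution,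
  through `TearingHarrisSheet.lean`.
-/

noncomputable section

open Real Set

namespace Literature.MathematicalPhysics.MHD

namespace Tearing.Saturation

/-! ## §1 Rutherford's coefficient: (4.40) with `w_I = 4√(ψ₁/ψ₀″)` is `ẇ_I = (π/(√2A))ηΔ′ = 1.22ηΔ′` -/

/-- THE COEFFICIENT OF RUTHERFORD'S EQUATION as it follows from (4.40) and (4.5): `π/(√2·A)`.
[cite: Biskamp2000, §4.1.2 eqs. (4.40)–(4.42)] -/
def rutherfordCoeff (A : ℝ) : ℝ := π / (Real.sqrt 2 * A)

/-- ★ (4.40) ⟹ (4.42): if `ψ₁ = w²ψ₀″/16` (the island width (4.5) `w = 4√(ψ₁/ψ₀″)`), so that `ψ̇₁ = wẇψ₀″/8`, then the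
flux-surface-averaged diffusion law (4.40) `(4/π)A√(ψ₁/(2ψ₀″))ψ̇₁ = ηΔ′ψ₁` reads `ẇ = (π/(√2A))ηΔ′`
(`w > 0`, `ψ₀″ > 0`, `A > 0`). [cite: Biskamp2000, §4.1.2 eqs. (4.5), (4.40), (4.42)] -/
theorem rutherford_of_averaged_law {A ψ0'' η Δ' w wdot : ℝ} (hA : 0 < A) (hψ : 0 < ψ0'') (hw : 0 < w)
    (h440 : 4 / π * A * Real.sqrt (w ^ 2 * ψ0'' / 16 / (2 * ψ0'')) * (w * wdot * ψ0'' / 8)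
      = η * Δ' * (w ^ 2 * ψ0'' / 16)) :
    wdot = rutherfordCoeff A * (η * Δ') := by
  unfold rutherfordCoeff
  have hsq : Real.sqrt (w ^ 2 * ψ0'' / 16 / (2 * ψ0'')) = w / (4 * Real.sqrt 2) := by
    have e : w ^ 2 * ψ0'' / 16 / (2 * ψ0'') = (w / (4 * Real.sqrt 2)) ^ 2 := by
      have hs : Real.sqrt 2 ^ 2 = 2 := Real.sq_sqrt (by norm_num)
      field_simp
      rw [hs]; ring
    rw [e, Real.sqrt_sq (by positivity)]
  rw [hsq] at h440
  have hπ : π ≠ 0 := Real.pi_pos.ne'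
  have hs2 : Real.sqrt 2 ≠ 0 := by positivity
  have hs : Real.sqrt 2 ^ 2 = 2 := Real.sq_sqrt (by norm_num)
  field_simp at h440
  field_simp
  linear_combination (Real.sqrt 2 / 16) * h440 + (π * η * Δ' / 2) * hs

/-- ★ THE PRINTED «1.22» with the printed `A = 1.827` (4.41): `1.215 < π/(√2·1.827) < 1.217`.
[cite: Biskamp2000, §4.1.2 eqs. (4.41)–(4.42)] -/
theorem rutherfordCoeff_bounds : 1.215 < rutherfordCoeff 1.827 ∧ rutherfordCoeff 1.827 < 1.217 := by
  unfold rutherfordCoeff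
  have hs2l : (1.414213 : ℝ) < Real.sqrt 2 := by
    rw [show (1.414213 : ℝ) = Real.sqrt (1.414213 ^ 2) by rw [Real.sqrt_sq (by norm_num)]]
    exact Real.sqrt_lt_sqrt (by norm_num) (by norm_num)
  have hs2u : Real.sqrt 2 < (1.414214 : ℝ) := by
    rw [show (1.414214 : ℝ) = Real.sqrt (1.414214 ^ 2) by rw [Real.sqrt_sq (by norm_num)]]
    exact Real.sqrt_lt_sqrt (by norm_num) (by norm_num)
  have hπl := Real.pi_gt_d6
  have hπu := Real.pi_lt_d6
  have hden : 0 < Real.sqrt 2 * 1.827 := by positivity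
  constructor
  · rw [lt_div_iff₀ hden]; nlinarith
  · rw [div_lt_iff₀ hden]; nlinarith

/-! ## §2 White et al.'s finite-amplitude `Δ′(w)` (4.45) for the Harris sheet, evaluated from the tree's (4.22) -/

/-- THE FINITE-AMPLITUDE TEARING PARAMETER (4.45) of the Harris sheet, over the tree's outer solution `ψ` (4.22):
`Δ′(w) = [ψ′(x_s + w/2) − ψ′(x_s − w/2)]/ψ(x_s)`, `x_s = 0`. [cite: Biskamp2000, §4.1.3 eq. (4.45)] -/
def deltaPrimeW (a k w : ℝ) : ℝ :=
  (HarrisSheet.psi' a k (w / 2) - HarrisSheet.psi' a k (-(w / 2))) / HarrisSheet.psi a k 0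

/-- The bracket of (4.47): `(1/(ka))sech²(u) − ka − tanh(u)` at `u = w/2a`, written with `cosh/sinh`.
[cite: Biskamp2000, §4.1.3 eq. (4.47)] -/
def bracket (a k u : ℝ) : ℝ := 1 / (k * a) * (1 / Real.cosh u ^ 2) - k * a - Real.sinh u / Real.cosh u

/-- `ψ(0) = 1` for the tree's Harris outer solution. [cite: Biskamp2000, §4.1.1 eq. (4.22)] -/
theorem psi_zero (a k : ℝ) : HarrisSheet.psi a k 0 = 1 := by
  simp [HarrisSheet.psi, HarrisSheet.psiPlus]

/-- ★ (4.47) EVALUATED IN THE KERNEL (reading of the print): for `w > 0`,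
`Δ′(w) = (2/a)e^{−kw/2}[(1/(ka))sech²(w/2a) − ka − tanh(w/2a)]` (the book prints `e^{−kw_I}`).
[cite: Biskamp2000, §4.1.3 eq. (4.47); §4.1.1 eq. (4.22)] -/
theorem deltaPrimeW_eq {a k w : ℝ} (ha : a ≠ 0) (hk : k ≠ 0) (hw : 0 < w) :
    deltaPrimeW a k w = 2 / a * Real.exp (-(k * w / 2)) * bracket a k (w / (2 * a)) := by
  unfold deltaPrimeW bracket
  rw [psi_zero, div_one]
  have hneg : ¬ (0 : ℝ) ≤ -(w / 2) := by push Not; linarith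
  simp only [HarrisSheet.psi', if_pos (by linarith : (0 : ℝ) ≤ w / 2), if_neg hneg, neg_neg, sub_neg_eq_add]
  unfold HarrisSheet.psiPlus'
  have hc : Real.cosh (w / 2 / a) ≠ 0 := (Real.cosh_pos _).ne'
  rw [show w / 2 / a = w / (2 * a) by ring, show -k * (w / 2) = -(k * w / 2) by ring]
  have hc' : Real.cosh (w / (2 * a)) ≠ 0 := (Real.cosh_pos _).ne'
  field_simp
  ring

/-- AT ZERO AMPLITUDE the bracket is `1/(ka) − ka`, so `Δ′(0⁺) → (2/a)(1/(ka) − ka)` = the tree's `HarrisSheet.deltaPrime`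
(4.23): `(2/a)·e⁰·bracket(0) = deltaPrime`. [cite: Biskamp2000, §4.1.1 eq. (4.23); §4.1.3 eq. (4.47)] -/
theorem limit_form_zero (a k : ℝ) :
    2 / a * Real.exp (-(k * 0 / 2)) * bracket a k (0 / (2 * a)) = HarrisSheet.deltaPrime a k := by
  unfold bracket HarrisSheet.deltaPrime
  simp

/-- The bracket is bounded by its zero-amplitude value: `bracket(u) ≤ 1/(ka) − ka` for `u ≥ 0`, `ka > 0`
(`sech² ≤ 1`, `tanh ≥ 0`). [cite: Biskamp2000, §4.1.3 eq. (4.47)] -/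
theorem bracket_le {a k u : ℝ} (hka : 0 < k * a) (hu : 0 ≤ u) : bracket a k u ≤ 1 / (k * a) - k * a := by
  unfold bracket
  have hc : 0 < Real.cosh u := Real.cosh_pos u
  have h1 : 1 / Real.cosh u ^ 2 ≤ 1 := by
    rw [div_le_one (by positivity)]
    have := Real.one_le_cosh u
    nlinarith
  have h2 : 0 ≤ Real.sinh u / Real.cosh u := div_nonneg (Real.sinh_nonneg_iff.2 hu) hc.le
  have h3 : 1 / (k * a) * (1 / Real.cosh u ^ 2) ≤ 1 / (k * a) * 1 :=
    mul_le_mul_of_nonneg_left h1 (by positivity)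
  linarith

/-- ★ «IN GENERAL `Δ′(w_I)` IS A DECREASING FUNCTION OF `w_I`», in the certified form available for the Harris sheet:
for `0 < ka ≤ 1` (the unstable band) and `w > 0`, `Δ′(w) ≤ Δ′(0) = (2/a)(1/(ka) − ka)`.
[cite: Biskamp2000, §4.1.3 eqs. (4.47)–(4.48)] -/
theorem deltaPrimeW_le_deltaPrime {a k w : ℝ} (ha : 0 < a) (hk : 0 < k) (hka : k * a ≤ 1) (hw : 0 < w) :
    deltaPrimeW a k w ≤ HarrisSheet.deltaPrime a k := by
  rw [deltaPrimeW_eq ha.ne' hk.ne' hw]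
  unfold HarrisSheet.deltaPrime
  have hka0 : 0 < k * a := mul_pos hk ha
  have hb := bracket_le (u := w / (2 * a)) hka0 (by positivity)
  have hb0 : 0 ≤ 1 / (k * a) - k * a := by
    rw [sub_nonneg, le_div_iff₀ hka0]; nlinarith
  have he : Real.exp (-(k * w / 2)) ≤ 1 := by
    rw [Real.exp_le_one_iff]; nlinarith
  have he0 : 0 < Real.exp (-(k * w / 2)) := Real.exp_pos _
  have h2a : 0 < 2 / a := by positivity
  rcases le_or_gt 0 (bracket a k (w / (2 * a))) with hpos | hneg
  · calc 2 / a * Real.exp (-(k * w / 2)) * bracket a k (w / (2 * a))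
        ≤ 2 / a * 1 * bracket a k (w / (2 * a)) := by
          apply mul_le_mul_of_nonneg_right _ hpos
          exact mul_le_mul_of_nonneg_left he h2a.le
      _ ≤ 2 / a * (1 / (k * a) - k * a) := by rw [mul_one]; exact mul_le_mul_of_nonneg_left hb h2a.le
  · have : 2 / a * Real.exp (-(k * w / 2)) * bracket a k (w / (2 * a)) < 0 :=
      mul_neg_of_pos_of_neg (mul_pos h2a he0) hneg
    have : 0 ≤ 2 / a * (1 / (k * a) - k * a) := mul_nonneg h2a.le hb0
    linarith

/-! ## §3 Saturation: (4.44)/(4.46) with `α`, and (4.48) `Δ′(w_s) = 0` SOLVED for the Harris sheet -/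

/-- WHITE ET AL.'S QUASI-LINEAR EVOLUTION (4.44) right side (per unit `1.22η`): `Δ′(w) − αw`.
[cite: Biskamp2000, §4.1.3 eq. (4.44)] -/
def whiteRHS (a k α w : ℝ) : ℝ := deltaPrimeW a k w - α * w

/-- SATURATION CONDITION (4.46): `Δ′(w_I) − αw_I = 0` (`α = (ka)² − 0.78` is the printed fit for the sheet pinch;
`α = 0` gives (4.48) «used in most practical applications»). [cite: Biskamp2000, §4.1.3 eqs. (4.46), (4.48)] -/
def IsSaturated (a k α w : ℝ) : Prop := 0 < w ∧ whiteRHS a k α w = 0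

/-- The printed fit `α = (ka)² − 0.78` (VALIDATED input, typed as a definition only).
[cite: Biskamp2000, §4.1.3 after eq. (4.47)] -/
def alphaFit (a k : ℝ) : ℝ := (k * a) ^ 2 - 0.78

/-- THE BRACKET AS A QUADRATIC IN `t = tanh u`: `bracket = (1 − t²)/(ka) − ka − t` (`sech² = 1 − tanh²`).
[cite: Biskamp2000, §4.1.3 eq. (4.47)] -/
theorem bracket_eq_quadratic (a k u : ℝ) :
    bracket a k u = (1 - (Real.sinh u / Real.cosh u) ^ 2) / (k * a) - k * a - Real.sinh u / Real.cosh u := by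
  unfold bracket
  have hc : Real.cosh u ≠ 0 := (Real.cosh_pos u).ne'
  have hid : 1 - (Real.sinh u / Real.cosh u) ^ 2 = 1 / Real.cosh u ^ 2 := by
    field_simp
    linear_combination Real.cosh_sq u
  rw [hid]
  ring

/-- THE SATURATION VALUE OF `tanh(w_s/2a)`: the positive root `t_s = (√(4 − 3k²a²) − ka)/2` of
`t² + (ka)t + (ka)² − 1 = 0`. [cite: Biskamp2000, §4.1.3 eqs. (4.47)–(4.48)] -/
def tanhSat (a k : ℝ) : ℝ := (Real.sqrt (4 - 3 * (k * a) ^ 2) - k * a) / 2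

/-- `t_s` is a root of `t² + (ka)t + (ka)² − 1` (for `(ka)² ≤ 4/3`). [cite: Biskamp2000, §4.1.3 eqs. (4.47)–(4.48)] -/
theorem tanhSat_root {a k : ℝ} (hka : 3 * (k * a) ^ 2 ≤ 4) :
    tanhSat a k ^ 2 + k * a * tanhSat a k + ((k * a) ^ 2 - 1) = 0 := by
  unfold tanhSat
  have hs : Real.sqrt (4 - 3 * (k * a) ^ 2) ^ 2 = 4 - 3 * (k * a) ^ 2 := Real.sq_sqrt (by linarith)
  nlinarith [hs]

/-- For `0 < ka < 1`: `0 < t_s < 1`. [cite: Biskamp2000, §4.1.3 eqs. (4.47)–(4.48)] -/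
theorem tanhSat_mem_Ioo {a k : ℝ} (hka0 : 0 < k * a) (hka1 : k * a < 1) : tanhSat a k ∈ Ioo 0 1 := by
  unfold tanhSat
  set κ := k * a with hκ
  have hrad : 0 ≤ 4 - 3 * κ ^ 2 := by nlinarith
  have hs2 : Real.sqrt (4 - 3 * κ ^ 2) ^ 2 = 4 - 3 * κ ^ 2 := Real.sq_sqrt hrad
  have hs0 : 0 ≤ Real.sqrt (4 - 3 * κ ^ 2) := Real.sqrt_nonneg _
  constructor
  · -- `κ < √(4 − 3κ²)` since `κ² < 4 − 3κ²`
    have h1 := Real.sqrt_lt_sqrt (sq_nonneg κ) (show κ ^ 2 < 4 - 3 * κ ^ 2 by nlinarith)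
    rw [Real.sqrt_sq hka0.le] at h1
    linarith
  · -- `√(4 − 3κ²) < 2 + κ`
    have h1 := Real.sqrt_lt_sqrt hrad (show 4 - 3 * κ ^ 2 < (2 + κ) ^ 2 by nlinarith)
    rw [Real.sqrt_sq (by linarith)] at h1
    linarith

/-- At the marginal wavenumber `ka = 1`: `t_s = 0` (so `w_s = 0`: «note that `ka = 1` is the marginally stable
wavenumber»). [cite: Biskamp2000, §4.1.3 after eq. (4.47)] -/
theorem tanhSat_marginal {a k : ℝ} (hka : k * a = 1) : tanhSat a k = 0 := by
  unfold tanhSat; rw [hka]; norm_num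

/-- For `0 < ka < 1` and `t ∈ [0, 1)`: the quadratic `(1 − t²)/(ka) − ka − t` vanishes iff `t = t_s` (the other root
is negative). [cite: Biskamp2000, §4.1.3 eqs. (4.47)–(4.48)] -/
theorem quadratic_eq_zero_iff {a k t : ℝ} (hka0 : 0 < k * a) (hka1 : k * a < 1) (ht : 0 ≤ t) :
    (1 - t ^ 2) / (k * a) - k * a - t = 0 ↔ t = tanhSat a k := by
  set κ := k * a with hκ
  have hroot := tanhSat_root (a := a) (k := k) (by nlinarith : 3 * (k * a) ^ 2 ≤ 4)
  obtain ⟨hts0, _⟩ := tanhSat_mem_Ioo hka0 hka1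
  rw [← hκ] at hroot
  have key : (1 - t ^ 2) / κ - κ - t = -(t ^ 2 + κ * t + (κ ^ 2 - 1)) / κ := by
    field_simp; ring
  rw [key, div_eq_zero_iff, or_iff_left hka0.ne', neg_eq_zero]
  constructor
  · intro h
    -- two roots of the same monic quadratic: `(t − t_s)(t + t_s + κ) = 0`, second factor positive
    have hfac : (t - tanhSat a k) * (t + tanhSat a k + κ) = 0 := by linear_combination h - hroot
    rcases mul_eq_zero.1 hfac with h1 | h1
    · linarith
    · exfalso; linarith
  · intro h; rw [h]; exact hroot

/-- `tanh` via `sinh/cosh` is a bijection `[0, ∞) → [0, 1)`: for `t ∈ [0, 1)` the unique `u ≥ 0` with `tanh u = t` is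
`u = ½log((1 + t)/(1 − t))`. [cite: Biskamp2000, §4.1.3 eq. (4.47)] -/
theorem sinh_div_cosh_halfLog {t : ℝ} (ht0 : 0 ≤ t) (ht1 : t < 1) :
    Real.sinh (1 / 2 * Real.log ((1 + t) / (1 - t))) / Real.cosh (1 / 2 * Real.log ((1 + t) / (1 - t))) = t := by
  set u := 1 / 2 * Real.log ((1 + t) / (1 - t)) with hu
  have hq : 0 < (1 + t) / (1 - t) := div_pos (by linarith) (by linarith)
  have he : Real.exp (2 * u) = (1 + t) / (1 - t) := by
    rw [hu, show 2 * (1 / 2 * Real.log ((1 + t) / (1 - t))) = Real.log ((1 + t) / (1 - t)) by ring,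
      Real.exp_log hq]
  rw [Real.sinh_eq, Real.cosh_eq]
  have hem : Real.exp (-u) = (Real.exp u)⁻¹ := Real.exp_neg u
  have heu : 0 < Real.exp u := Real.exp_pos u
  have he2 : Real.exp u ^ 2 = (1 + t) / (1 - t) := by rw [← he, ← Real.exp_nat_mul]; norm_num
  rw [hem]
  have h1t : (1 - t) ≠ 0 := by linarith
  field_simp
  rw [he2]
  field_simp
  ring

/-- `sinh u/cosh u` is injective on `[0, ∞)` (strictly increasing). [cite: Biskamp2000, §4.1.3 eq. (4.47)] -/
theorem sinh_div_cosh_strictMonoOn : StrictMono fun u : ℝ => Real.sinh u / Real.cosh u := by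
  -- `tanh′ = sech² > 0`
  apply strictMono_of_deriv_pos
  intro u
  have h : HasDerivAt (fun u : ℝ => Real.sinh u / Real.cosh u)
      ((Real.cosh u * Real.cosh u - Real.sinh u * Real.sinh u) / Real.cosh u ^ 2) u :=
    (Real.hasDerivAt_sinh u).div (Real.hasDerivAt_cosh u) (Real.cosh_pos u).ne'
  rw [h.deriv]
  have hc : 0 < Real.cosh u := Real.cosh_pos u
  have : Real.cosh u * Real.cosh u - Real.sinh u * Real.sinh u = 1 := by nlinarith [Real.cosh_sq u]
  rw [this]; positivity

/-- THE SATURATED ISLAND WIDTH OF THE HARRIS SHEET IN CLOSED FORM: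
`w_s = a·log((1 + t_s)/(1 − t_s))`, `t_s = (√(4 − 3k²a²) − ka)/2`. [cite: Biskamp2000, §4.1.3 eqs. (4.47)–(4.48)] -/
def satWidth (a k : ℝ) : ℝ := a * Real.log ((1 + tanhSat a k) / (1 - tanhSat a k))

/-- `w_s > 0` for `0 < ka < 1`, `a > 0`. [cite: Biskamp2000, §4.1.3 eqs. (4.47)–(4.48)] -/
theorem satWidth_pos {a k : ℝ} (ha : 0 < a) (hka0 : 0 < k * a) (hka1 : k * a < 1) : 0 < satWidth a k := by
  obtain ⟨h0, h1⟩ := tanhSat_mem_Ioo hka0 hka1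
  unfold satWidth
  refine mul_pos ha (Real.log_pos ?_)
  rw [one_lt_div (by linarith)]; linarith

/-- `w_s = 0` at the marginal point `ka = 1`. [cite: Biskamp2000, §4.1.3 after eq. (4.47)] -/
theorem satWidth_marginal {a k : ℝ} (hka : k * a = 1) : satWidth a k = 0 := by
  unfold satWidth; rw [tanhSat_marginal hka]; simp

/-- ★ (4.48) SOLVED: for the Harris sheet with `0 < ka < 1` (`a > 0`) and `w > 0`,
`Δ′(w) = 0 ⟺ w = w_s = a·log((1 + t_s)/(1 − t_s))` — the saturated island width of the rule «`Δ′(w_I) = 0`» is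
UNIQUE and EXPLICIT. [cite: Biskamp2000, §4.1.3 eqs. (4.45), (4.47), (4.48)] -/
theorem deltaPrimeW_eq_zero_iff {a k w : ℝ} (ha : 0 < a) (hk : 0 < k) (hka1 : k * a < 1) (hw : 0 < w) :
    deltaPrimeW a k w = 0 ↔ w = satWidth a k := by
  have hka0 : 0 < k * a := mul_pos hk ha
  obtain ⟨hts0, hts1⟩ := tanhSat_mem_Ioo hka0 hka1
  rw [deltaPrimeW_eq ha.ne' hk.ne' hw]
  have hpre : 2 / a * Real.exp (-(k * w / 2)) ≠ 0 := by positivity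
  rw [mul_eq_zero, or_iff_right hpre, bracket_eq_quadratic,
    quadratic_eq_zero_iff hka0 hka1 (div_nonneg (Real.sinh_nonneg_iff.2 (by positivity)) (Real.cosh_pos _).le)]
  -- `tanh(w/2a) = t_s ⟺ w/2a = ½log((1+t_s)/(1−t_s)) ⟺ w = w_s`
  have hval := sinh_div_cosh_halfLog hts0.le hts1
  constructor
  · intro h
    have hinj := sinh_div_cosh_strictMonoOn.injective (a₁ := w / (2 * a))
      (a₂ := 1 / 2 * Real.log ((1 + tanhSat a k) / (1 - tanhSat a k))) (by rw [h, hval])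
    unfold satWidth
    field_simp at hinj
    linarith
  · intro h
    rw [h]
    unfold satWidth
    rw [show a * Real.log ((1 + tanhSat a k) / (1 - tanhSat a k)) / (2 * a)
        = 1 / 2 * Real.log ((1 + tanhSat a k) / (1 - tanhSat a k)) by field_simp]
    exact hval

/-- COROLLARY in the words of (4.48): for `0 < ka < 1` the Harris sheet has EXACTLY ONE saturated island width
under the rule `Δ′(w_I) = 0` (`α = 0`), namely `w_s`. [cite: Biskamp2000, §4.1.3 eq. (4.48)] -/
theorem existsUnique_isSaturated {a k : ℝ} (ha : 0 < a) (hk : 0 < k) (hka1 : k * a < 1) :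
    ∃! w, IsSaturated a k 0 w := by
  have hka0 : 0 < k * a := mul_pos hk ha
  refine ⟨satWidth a k, ⟨satWidth_pos ha hka0 hka1, ?_⟩, ?_⟩
  · unfold whiteRHS
    rw [zero_mul, sub_zero]
    exact (deltaPrimeW_eq_zero_iff ha hk hka1 (satWidth_pos ha hka0 hka1)).2 rfl
  · rintro w ⟨hw, h⟩
    unfold whiteRHS at h
    rw [zero_mul, sub_zero] at h
    exact (deltaPrimeW_eq_zero_iff ha hk hka1 hw).1 h

end Tearing.Saturation

end Literature.MathematicalPhysics.MHD
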